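import Literature.GroupTheory.ArithmeticGroups.SL2Mod8SchurMultiplier
import Literature.GroupTheory.ArithmeticGroups.SL2TwoPowCentralExtension
import HarnessLib

/-!
# The `2`-part of the Schur multiplier of `SL₂(ℤ/2^e)`: the top layer for `p = 2` (all `e ≥ 3`)

(First half of the all-levels argument; the descent itself is in `SL2TwoPowSchurMultiplierAll`.)

We complete the `2`-adic descent.  `SL2TwoPowSchurMultiplier.step` needs the commutation of `e_h = t^a` and
`f_h = l^a` (`a = 2^{e-2}`), proved there for `e ≥ 5` by a parity argument.  Here we prove it for every `e ≥ 4`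
UNDER THE HYPOTHESIS `τ = t^{2^e} = 1`: `[t^a, l⁴] = [t^a, l²] · l²[t^a, l²]l⁻² = c²` where `c = [t^a, l²]` lies
over the central scalar `(1+ϖ)·1`, so that `g ↦ [g, c]` is a homomorphism into the kernel and `l²` centralises
`c`; and `c² = 1` because the top-layer preimage is abelian of exponent `2` when `τ = 1`
(`sq_eq_one_of_layer₂`, all `e ≥ 3`).  Consequently `P(e-1) ⟹ P(e)` for every `e ≥ 4` (`P_succ`), and with the
base `P(3)` (`SL2Mod8.eq_one_of_tau_eq_one`):

* `eq_one_of_tau_eq_one` (**`P(e)` for all `e ≥ 3`**): a central extension of `SL₂(ℤ/2^e)` with kernel of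
  exponent `2` and a lift `t` of `T̄` with `t^{2^e} = 1` has `ker ∩ [E, E] = 1`;
* `mem_zpowers_tau` (`e ≥ 5`): in general `ker ∩ [E, E] ⊆ ⟨t^{2^e}⟩`.

This is the `2`-primary counterpart of [Beyl1986] needed for the `SL₂(ℤ)`-invariant form of
[CalegariDimitrovTang2025, Corollary 4.5.3] at levels `4 ∣ N`.
-/

open scoped MatrixGroups commutatorElement

universe u

namespace Literature.GroupTheory.ArithmeticGroups

namespace SL2TwoPowTopLayerExp2

open Matrix.SpecialLinearGroup

section anyring

variable {R : Type*} [CommRing R]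

/-- `[(1 ϖ; 0 1), (1 0; a 1)] = 1` when `ϖa = 0`. [cite: CalegariDimitrovTang2025, §4.5, Lemma 4.5.9] -/
theorem eBar_comm_la {ϖ a : R} (h : ϖ * a = 0) (Eb La : SL(2, R))
    (hE : (Eb : Matrix (Fin 2) (Fin 2) R) = !![1, ϖ; 0, 1]) (hLa : (La : Matrix (Fin 2) (Fin 2) R) = !![1, 0; a, 1]) :
    ⁅Eb, La⁆ = 1 := by
  apply Subtype.ext
  rw [commutatorElement_def, coe_mul, coe_mul, coe_mul, coe_inv, coe_inv, hE, hLa]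
  have h' : a * ϖ = 0 := by rw [mul_comm]; exact h
  ext i j; fin_cases i <;> fin_cases j <;>
    simp [Matrix.mul_apply, Fin.sum_univ_two, Matrix.adjugate_fin_two] <;> grind

/-- `[(1 a; 0 1), L̄²] = (1+2a 0; 0 1-2a)` when `a² = 0` and `4a = 0`. [cite: CalegariDimitrovTang2025, §4.5,
Lemma 4.5.9] -/
theorem coe_ta_comm_lBar_sq {a : R} (ha : a * a = 0) (ha4 : 4 * a = 0) (Ta L : SL(2, R))
    (hTa : (Ta : Matrix (Fin 2) (Fin 2) R) = !![1, a; 0, 1]) (hL : (L : Matrix (Fin 2) (Fin 2) R) = !![1, 0; 1, 1]) :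
    ((⁅Ta, L ^ 2⁆ : SL(2, R)) : Matrix (Fin 2) (Fin 2) R) = !![1 + 2 * a, 0; 0, 1 - 2 * a] := by
  have hL2 := SL2TopLayer.lBar_pow L hL 2
  rw [commutatorElement_def, coe_mul, coe_mul, coe_mul, coe_inv, coe_inv, hTa, hL2]
  have ha4' : a * 4 = 0 := by rw [mul_comm]; exact ha4
  ext i j; fin_cases i <;> fin_cases j <;>
    simp [Matrix.mul_apply, Fin.sum_univ_two, Matrix.adjugate_fin_two] <;>
    first
      | linear_combination 4 * ha
      | linear_combination (-2) * ha
      | linear_combination 2 * ha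
      | linear_combination ha4
      | linear_combination ha4'
      | ring1

/-- A diagonal matrix `(1+ϖ 0; 0 1-ϖ)` with `2ϖ = 0` is the scalar `1+ϖ`, hence central. [cite:
CalegariDimitrovTang2025, §4.5, Lemma 4.5.9] -/
theorem comm_of_coe_diag {ϖ : R} (h2 : 2 * ϖ = 0) (S : SL(2, R))
    (hS : (S : Matrix (Fin 2) (Fin 2) R) = !![1 + ϖ, 0; 0, 1 - ϖ]) (g : SL(2, R)) : g * S = S * g := by
  have h : (1 : R) - ϖ = 1 + ϖ := by
    have : ϖ + ϖ = 0 := by rw [← two_mul]; exact h2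
    linear_combination -this
  apply Subtype.ext
  rw [coe_mul, coe_mul, hS, h]
  ext i j; fin_cases i <;> fin_cases j <;> simp [Matrix.mul_apply, Fin.sum_univ_two] <;> ring

end anyring

variable {e : ℕ} {E : Type u} [Group E] {π : E →* SL(2, ZMod (2 ^ e))}

section topLayer

variable (hcen : ∀ z : E, π z = 1 → ∀ g : E, g * z = z * g) (hK2 : ∀ z : E, π z = 1 → z ^ 2 = 1)
variable {t l e₀ f₀ h₁ : E} (he₀ : e₀ = t ^ 2 ^ (e - 1)) (hf₀ : f₀ = l ^ 2 ^ (e - 1))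
  (hh₁ : h₁ = t * f₀ * t⁻¹ * f₀⁻¹ * e₀)
  (ht : ((π t : SL(2, ZMod (2 ^ e))) : Matrix (Fin 2) (Fin 2) (ZMod (2 ^ e))) = !![1, 1; 0, 1])
  (hl : ((π l : SL(2, ZMod (2 ^ e))) : Matrix (Fin 2) (Fin 2) (ZMod (2 ^ e))) = !![1, 0; 1, 1])

include hcen hK2 he₀ hf₀ ht hl in
/-- **`e₀` and `f₀` commute** (`p = 2`, `e ≥ 3`): `[e₀, f₀] = [e₀, l^{2^{e-2}}]²` and `[e₀, l^{2^{e-2}}]` is central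
(its image is `[(1 ϖ;0 1), (1 0; ϖ/2 1)] = 1` as `ϖ·ϖ/2 = 2^{2e-3} = 0`). [cite: Beyl1986, Theorem (Schur
multiplier of SL(2,ℤ/m)), 2-primary part] -/
theorem commute_e₀_f₀ (he : 3 ≤ e) : Commute e₀ f₀ := by
  have hcoe_la : ((π (l ^ 2 ^ (e - 2)) : SL(2, ZMod (2 ^ e))) : Matrix (Fin 2) (Fin 2) (ZMod (2 ^ e))) =
      !![1, 0; (2 : ZMod (2 ^ e)) ^ (e - 2), 1] := by
    rw [map_pow, SL2TopLayer.lBar_pow _ hl, Nat.cast_pow, Nat.cast_ofNat]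
  have hE := SL2CentralExtension.coe_map_e₀' (π := π) he₀ ht
  rw [Nat.cast_ofNat] at hE
  have hprod : (2 : ZMod (2 ^ e)) ^ (e - 1) * (2 : ZMod (2 ^ e)) ^ (e - 2) = 0 := by
    have h : ((2 ^ (e - 1) * 2 ^ (e - 2) : ℕ) : ZMod (2 ^ e)) = 0 := by
      rw [ZMod.natCast_eq_zero_iff, ← pow_add]; exact pow_dvd_pow 2 (by omega)
    exact_mod_cast h
  have hκ : π ⁅e₀, l ^ 2 ^ (e - 2)⁆ = 1 := by
    rw [map_commutatorElement]
    exact eBar_comm_la hprod (π e₀) (π (l ^ 2 ^ (e - 2))) hE hcoe_la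
  have hc : ∀ g : E, g * ⁅e₀, l ^ 2 ^ (e - 2)⁆ = ⁅e₀, l ^ 2 ^ (e - 2)⁆ * g := fun g ↦ hcen _ hκ g
  have hf : f₀ = (l ^ 2 ^ (e - 2)) ^ 2 := by
    rw [hf₀, ← pow_mul, ← pow_succ, show e - 2 + 1 = e - 1 by omega]
  rw [← commutatorElement_eq_one_iff_commute, hf, SL2TwoPowCentralExtension.commutatorElement_pow_right hc,
    hK2 _ hκ]

include hcen hK2 he₀ hf₀ hh₁ ht hl in
/-- **The top-layer preimage `A` is abelian** (`p = 2`, `e ≥ 3`). [cite: Beyl1986, Theorem (Schur multiplier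
of SL(2,ℤ/m)), 2-primary part] -/
theorem comm_of_layer₂ (he : 3 ≤ e) {x x' : E}
    (hx : Matrix.SpecialLinearGroup.map (ZMod.castHom (pow_dvd_pow 2 (Nat.sub_le e 1)) (ZMod (2 ^ (e - 1))))
      (π x) = 1)
    (hx' : Matrix.SpecialLinearGroup.map (ZMod.castHom (pow_dvd_pow 2 (Nat.sub_le e 1)) (ZMod (2 ^ (e - 1))))
      (π x') = 1) : x * x' = x' * x := by
  haveI : Fact (Nat.Prime 2) := ⟨Nat.prime_two⟩
  have he2 : 2 ≤ e := by omega
  obtain ⟨a, b, c, z, hz, rfl⟩ := SL2CentralExtension.exists_decomp he₀ hf₀ hh₁ ht hl he2 hx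
  obtain ⟨a', b', c', z', hz', rfl⟩ := SL2CentralExtension.exists_decomp he₀ hf₀ hh₁ ht hl he2 hx'
  have heh := SL2CentralExtension.commute_e₀_h₁ hcen he₀ hf₀ hh₁ ht hl he2
  have hfh := SL2CentralExtension.commute_f₀_h₁ hcen he₀ hf₀ hh₁ ht hl he2
  have hef := commute_e₀_f₀ hcen hK2 he₀ hf₀ ht hl he
  have hgen : ∀ {v : E}, (v = e₀ ∨ v = h₁ ∨ v = f₀) → Commute v (e₀ ^ b' * h₁ ^ a' * f₀ ^ c' * z') := by
    intro v hv
    have hvz : Commute v z' := (hcen z' hz' v)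
    rcases hv with rfl | rfl | rfl
    · exact ((((Commute.refl v).pow_right _).mul_right (heh.pow_right _)).mul_right (hef.pow_right _)).mul_right hvz
    · exact (((heh.symm.pow_right _).mul_right ((Commute.refl v).pow_right _)).mul_right
        (hfh.symm.pow_right _)).mul_right hvz
    · exact (((hef.symm.pow_right _).mul_right (hfh.pow_right _)).mul_right
        ((Commute.refl v).pow_right _)).mul_right hvz
  have hzc : Commute z (e₀ ^ b' * h₁ ^ a' * f₀ ^ c' * z') := (hcen z hz _).symm
  exact ((((hgen (Or.inl rfl)).pow_left b).mul_left ((hgen (Or.inr (Or.inl rfl))).pow_left a)).mul_left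
    ((hgen (Or.inr (Or.inr rfl))).pow_left c)).mul_left hzc |>.eq

include hcen hK2 he₀ hf₀ hh₁ ht hl in
/-- **With `t^{2^e} = 1` the top-layer preimage has exponent `2`** (`p = 2`, `e ≥ 3`). [cite: Beyl1986, Theorem
(Schur multiplier of SL(2,ℤ/m)), 2-primary part] -/
theorem sq_eq_one_of_layer₂ (he : 3 ≤ e) (hτ : t ^ 2 ^ e = 1) {x : E}
    (hx : Matrix.SpecialLinearGroup.map (ZMod.castHom (pow_dvd_pow 2 (Nat.sub_le e 1)) (ZMod (2 ^ (e - 1))))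
      (π x) = 1) : x * x = 1 := by
  haveI : Fact (Nat.Prime 2) := ⟨Nat.prime_two⟩
  have he2 : 2 ≤ e := by omega
  have heh := SL2CentralExtension.commute_e₀_h₁ hcen he₀ hf₀ hh₁ ht hl he2
  have hfh := SL2CentralExtension.commute_f₀_h₁ hcen he₀ hf₀ hh₁ ht hl he2
  have hef := commute_e₀_f₀ hcen hK2 he₀ hf₀ ht hl he
  have he2' : e₀ * e₀ = 1 := by
    rw [he₀, ← pow_two, ← pow_mul, ← pow_succ, show e - 1 + 1 = e by omega, hτ]
  have hf2 : f₀ * f₀ = 1 := by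
    rw [hf₀, ← pow_two, ← pow_mul, ← pow_succ, show e - 1 + 1 = e by omega,
      SL2TwoPowCentralExtension.lpow_eq_tau_inv hcen hK2 ht hl (by omega), hτ, inv_one]
  have hA : ∀ v : E, Matrix.SpecialLinearGroup.map (ZMod.castHom (pow_dvd_pow 2 (Nat.sub_le e 1))
      (ZMod (2 ^ (e - 1)))) (π v) = 1 → ∀ w : E, Matrix.SpecialLinearGroup.map
      (ZMod.castHom (pow_dvd_pow 2 (Nat.sub_le e 1)) (ZMod (2 ^ (e - 1)))) (π w) = 1 → v * w = w * v :=
    fun v hv w hw ↦ comm_of_layer₂ hcen hK2 he₀ hf₀ hh₁ ht hl he hv hw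
  have hlay_e := SL2CentralExtension.layer_e₀ (π := π) he₀ ht
  have hlay_f := SL2CentralExtension.layer_f₀ (π := π) hf₀ hl
  have hlay_x : Matrix.SpecialLinearGroup.map (ZMod.castHom (pow_dvd_pow 2 (Nat.sub_le e 1))
      (ZMod (2 ^ (e - 1)))) (π (t * f₀ * t⁻¹)) = 1 := by
    rw [map_mul, map_mul, map_mul, map_mul, hlay_f, mul_one, map_inv, map_inv, mul_inv_cancel]
  have hh2 : h₁ * h₁ = 1 := by
    have hx2 : (t * f₀ * t⁻¹) * (t * f₀ * t⁻¹) = 1 := by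
      rw [show (t * f₀ * t⁻¹) * (t * f₀ * t⁻¹) = t * (f₀ * f₀) * t⁻¹ by group, hf2]; group
    have h1 : h₁ = (t * f₀ * t⁻¹) * f₀⁻¹ * e₀ := by rw [hh₁]
    have c1 : (t * f₀ * t⁻¹) * f₀⁻¹ = f₀⁻¹ * (t * f₀ * t⁻¹) := by
      have := hA _ hlay_x _ hlay_f
      calc (t * f₀ * t⁻¹) * f₀⁻¹ = f₀⁻¹ * (f₀ * (t * f₀ * t⁻¹)) * f₀⁻¹ := by group
        _ = f₀⁻¹ * ((t * f₀ * t⁻¹) * f₀) * f₀⁻¹ := by rw [this]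
        _ = f₀⁻¹ * (t * f₀ * t⁻¹) := by group
    have c2 : (t * f₀ * t⁻¹) * e₀ = e₀ * (t * f₀ * t⁻¹) := hA _ hlay_x _ hlay_e
    have c3 : f₀⁻¹ * e₀ = e₀ * f₀⁻¹ := hef.inv_right.symm.eq
    calc h₁ * h₁ = (t * f₀ * t⁻¹) * f₀⁻¹ * e₀ * ((t * f₀ * t⁻¹) * f₀⁻¹ * e₀) := by rw [h1]
      _ = (t * f₀ * t⁻¹) * f₀⁻¹ * (e₀ * (t * f₀ * t⁻¹)) * f₀⁻¹ * e₀ := by group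
      _ = (t * f₀ * t⁻¹) * f₀⁻¹ * ((t * f₀ * t⁻¹) * e₀) * f₀⁻¹ * e₀ := by rw [c2]
      _ = (t * f₀ * t⁻¹) * (f₀⁻¹ * (t * f₀ * t⁻¹)) * (e₀ * f₀⁻¹) * e₀ := by group
      _ = (t * f₀ * t⁻¹) * ((t * f₀ * t⁻¹) * f₀⁻¹) * (f₀⁻¹ * e₀) * e₀ := by rw [← c1, ← c3]
      _ = ((t * f₀ * t⁻¹) * (t * f₀ * t⁻¹)) * (f₀ * f₀)⁻¹ * (e₀ * e₀) := by group
      _ = 1 := by rw [hx2, hf2, he2']; group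
  obtain ⟨a, b, c, z, hz, rfl⟩ := SL2CentralExtension.exists_decomp he₀ hf₀ hh₁ ht hl he2 hx
  have hz2 : z * z = 1 := by rw [← pow_two]; exact hK2 z hz
  have hsq : ∀ (v : E) (n : ℕ), v * v = 1 → v ^ n * v ^ n = 1 := by
    intro v n hv; rw [← pow_add, ← two_mul, pow_mul, pow_two, hv, one_pow]
  have cEH : Commute (e₀ ^ b) (h₁ ^ a) := heh.pow_pow b a
  have cEF : Commute (e₀ ^ b) (f₀ ^ c) := hef.pow_pow b c
  have cHF : Commute (h₁ ^ a) (f₀ ^ c) := hfh.symm.pow_pow a c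
  have cz : ∀ w : E, Commute z w := fun w ↦ (hcen z hz w).symm
  calc e₀ ^ b * h₁ ^ a * f₀ ^ c * z * (e₀ ^ b * h₁ ^ a * f₀ ^ c * z)
      = (e₀ ^ b * e₀ ^ b) * (h₁ ^ a * h₁ ^ a) * (f₀ ^ c * f₀ ^ c) * (z * z) := by
        have h1 := (cz (e₀ ^ b * h₁ ^ a * f₀ ^ c)).eq
        have h2 := cHF.eq; have h3 := cEF.eq; have h4 := cEH.eq
        calc e₀ ^ b * h₁ ^ a * f₀ ^ c * z * (e₀ ^ b * h₁ ^ a * f₀ ^ c * z)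
            = e₀ ^ b * h₁ ^ a * f₀ ^ c * (z * (e₀ ^ b * h₁ ^ a * f₀ ^ c)) * z := by group
          _ = e₀ ^ b * h₁ ^ a * f₀ ^ c * ((e₀ ^ b * h₁ ^ a * f₀ ^ c) * z) * z := by rw [h1]
          _ = e₀ ^ b * h₁ ^ a * (f₀ ^ c * e₀ ^ b) * h₁ ^ a * f₀ ^ c * (z * z) := by group
          _ = e₀ ^ b * h₁ ^ a * (e₀ ^ b * f₀ ^ c) * h₁ ^ a * f₀ ^ c * (z * z) := by rw [h3]
          _ = e₀ ^ b * (h₁ ^ a * e₀ ^ b) * (f₀ ^ c * h₁ ^ a) * f₀ ^ c * (z * z) := by group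
          _ = e₀ ^ b * (e₀ ^ b * h₁ ^ a) * (h₁ ^ a * f₀ ^ c) * f₀ ^ c * (z * z) := by rw [← h4, h2]
          _ = (e₀ ^ b * e₀ ^ b) * (h₁ ^ a * h₁ ^ a) * (f₀ ^ c * f₀ ^ c) * (z * z) := by group
    _ = 1 := by rw [hsq e₀ b he2', hsq h₁ a hh2, hsq f₀ c hf2, hz2]; group

end topLayer

end SL2TwoPowTopLayerExp2

end Literature.GroupTheory.ArithmeticGroups
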